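import Literature.NumberTheory.LFunctions.PerronFormulaPsi
import HarnessLib

/-!
# Landau's formula `∑_{|γ| ≤ T} x^ρ`: the Dirichlet-series side on `Re s = 2`

Topic: `Literature/NumberTheory/LFunctions`. THEOREMS (everything proved). Third step of the proof
of Landau's formula over the zeros of `ζ` in the uniform (crude) form of Gonek 1993 Thm. 1: the
right edge of the contour, on the line `Re s = 2`, where `−ζ'/ζ(s) x^s = ∑_n Λ(n) (x/n)^s`
converges absolutely and may be integrated termwise:

  `∫_{−T}^{T} (−ζ'/ζ)(2+it) x^{2+it} dt = ∑_n Λ(n) (x/n)² ∫_{−T}^{T} (x/n)^{it} dt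
     = 2T·Λ(x) + E`,   `|E| ≤ C (x² + x² min(T, x/⟨x⟩))`

(`rightLine_bound`): the term `n = x` (present only when `x` is a prime power) gives the main
term `2T Λ(x)`, for `n ≠ x` the oscillatory integral is `≤ min(2T, 2/|log(x/n)|)`
(`norm_integral_cpow_mul_I_le`; `|y^{it}| = 1`), and `|log(x/n)| ≥ log 2` unless `x/2 < n < 2x`, where
`|log(x/n)| ≥ |x − n|/(2x) ≥ ⟨x⟩/(2x)` for the prime powers `n ≠ x`
(`PerronPsi.abs_sub_div_le_abs_log`, `PerronPsi.primePowDist_le`; `⟨x⟩ = primePowDist x`). Gonek's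
sharper book-keeping (`x log 2x` in place of `x²`, by Brun–Titchmarsh) is not attempted.

## References

* S. M. Gonek, *An explicit formula of Landau and its applications to the theory of the
  zeta-function*, Contemp. Math. 143 (1993), 395–413, Thm. 1 (proof). [Gonek1993]
* H. L. Montgomery, R. C. Vaughan, *Multiplicative Number Theory I*, CUP 2007, Cor. 5.3 (the
  estimate `|log(x/n)| ≍ |x − n|/x`). [MontgomeryVaughan2007]
-/

noncomputable section

open Complex Set MeasureTheory Filter Topology intervalIntegral Real
open ArithmeticFunction hiding log id
open scoped Chebyshev Interval

namespace Literature.NumberTheory.LFunctions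

namespace LandauGonek

open PerronPsi

/-! ### The Dirichlet series of `Λ` against `x^s` -/

/-- **`∑_n Λ(n) (x/n)^s = (−ζ'/ζ)(s) x^s`** for `x > 0`, `Re s > 1` (Mathlib's `−ζ'/ζ = L(Λ, s)`).
[folklore] -/
theorem hasSum_vonMangoldt_mul_cpow {x : ℝ} (hx : 0 < x) {s : ℂ} (hs : 1 < s.re) :
    HasSum (fun n : ℕ ↦ (Λ n : ℂ) * (((x / n : ℝ)) : ℂ) ^ s)
      ((-deriv riemannZeta s / riemannZeta s) * (x : ℂ) ^ s) := by
  have h1 : HasSum (LSeries.term (fun n ↦ (Λ n : ℂ)) s) (LSeries (fun n ↦ (Λ n : ℂ)) s) :=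
    (ArithmeticFunction.LSeriesSummable_vonMangoldt hs).hasSum
  rw [ArithmeticFunction.LSeries_vonMangoldt_eq_deriv_riemannZeta_div hs] at h1
  have h2 := h1.mul_right ((x : ℂ) ^ s)
  have hfun : (fun n : ℕ ↦ (Λ n : ℂ) * (((x / n : ℝ)) : ℂ) ^ s) =
      fun n ↦ LSeries.term (fun n ↦ (Λ n : ℂ)) s n * (x : ℂ) ^ s := by
    funext n
    rcases Nat.eq_zero_or_pos n with rfl | hn
    · have hs0 : s ≠ 0 := fun h ↦ by rw [h] at hs; simp at hs; linarith
      simp [zero_cpow hs0]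
    · rw [LSeries.term_of_ne_zero hn.ne', ofReal_div_cpow hx.le (by exact_mod_cast hn) s]
      have hn0 : ((n : ℝ) : ℂ) ^ s ≠ 0 := by
        rw [Ne, cpow_eq_zero_iff, not_and_or]
        exact Or.inl (by exact_mod_cast hn.ne')
      push_cast
      field_simp
  rw [hfun]
  exact h2

/-! ### The oscillatory integral `∫_{-T}^{T} y^{it} dt` -/

/-- **The oscillatory integral.** For `y > 0`, `y ≠ 1`, `T ≥ 0`:
`‖∫_{-T}^{T} y^{it} dt‖ ≤ min(2T, 2/|log y|)` (`y^{it} = e^{it log y}`). [folklore] -/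
theorem norm_integral_cpow_mul_I_le {y : ℝ} (hy : 0 < y) (hy1 : y ≠ 1) {T : ℝ} (hT : 0 ≤ T) :
    ‖∫ t in (-T)..T, (y : ℂ) ^ ((t : ℂ) * I)‖ ≤ min (2 * T) (2 / |Real.log y|) := by
  have hL : Real.log y ≠ 0 := Real.log_ne_zero_of_pos_of_ne_one hy hy1
  refine le_min ?_ ?_
  · have h := intervalIntegral.norm_integral_le_of_norm_le_const (a := -T) (b := T)
      (f := fun t : ℝ ↦ (y : ℂ) ^ ((t : ℂ) * I)) (C := 1) (fun t _ ↦ by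
        rw [Complex.norm_cpow_eq_rpow_re_of_pos hy]; simp)
    rw [show |T - -T| = 2 * T by rw [sub_neg_eq_add, abs_of_nonneg (by linarith)]; ring] at h
    linarith
  · set c : ℂ := (Real.log y : ℂ) * I with hc
    have hc0 : c ≠ 0 := mul_ne_zero (by exact_mod_cast hL) I_ne_zero
    have hfun : (fun t : ℝ ↦ (y : ℂ) ^ ((t : ℂ) * I)) = fun t : ℝ ↦ Complex.exp (c * t) := by
      funext t
      rw [cpow_def_of_ne_zero (by exact_mod_cast hy.ne'), ← ofReal_log hy.le, hc]
      ring_nf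
    rw [hfun, integral_exp_mul_complex hc0]
    have hn : ∀ u : ℝ, ‖Complex.exp (c * u)‖ = 1 := by
      intro u
      rw [Complex.norm_exp, hc]
      simp
    have hnum : ‖Complex.exp (c * T) - Complex.exp (c * (-T : ℝ))‖ ≤ 2 := by
      refine (norm_sub_le _ _).trans ?_
      rw [hn, hn]; norm_num
    have hcn : ‖c‖ = |Real.log y| := by
      rw [hc, norm_mul, norm_I, mul_one, norm_real, Real.norm_eq_abs]
    rw [norm_div, hcn]
    exact div_le_div_of_nonneg_right hnum (abs_nonneg _)

/-- At `y = 1`: `∫_{-T}^{T} 1^{it} dt = 2T`. [folklore] -/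
theorem integral_one_cpow_mul_I (T : ℝ) :
    ∫ t in (-T)..T, ((1 : ℝ) : ℂ) ^ ((t : ℂ) * I) = 2 * T := by
  simp only [ofReal_one, one_cpow]
  rw [intervalIntegral.integral_const, Complex.real_smul, mul_one]
  push_cast
  ring

/-! ### The terms `Λ(n) (x/n)^{2+it}` -/

/-- `y^{2+it} = y² y^{it}` (`y > 0`). [folklore] -/
theorem cpow_two_add {y : ℝ} (hy : 0 < y) (t : ℝ) :
    ((y : ℝ) : ℂ) ^ (((2 : ℝ) : ℂ) + (t : ℂ) * I) = ((y ^ 2 : ℝ) : ℂ) * (y : ℂ) ^ ((t : ℂ) * I) := by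
  rw [cpow_add _ _ (by exact_mod_cast hy.ne'), ← ofReal_cpow hy.le, Real.rpow_two]

/-- `‖Λ(n) (x/n)^{2+it}‖ ≤ Λ(n) (x/n)²`. [folklore] -/
theorem norm_term_le {x : ℝ} (hx : 0 < x) (n : ℕ) (t : ℝ) :
    ‖(Λ n : ℂ) * (((x / n : ℝ)) : ℂ) ^ (((2 : ℝ) : ℂ) + (t : ℂ) * I)‖ ≤ Λ n * (x / n) ^ 2 := by
  rcases Nat.eq_zero_or_pos n with rfl | hn
  · simp
  · have hy : 0 < x / n := div_pos hx (by exact_mod_cast hn)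
    have h1 : ‖((x / n : ℝ) : ℂ) ^ ((t : ℂ) * I)‖ = 1 := by
      rw [Complex.norm_cpow_eq_rpow_re_of_pos hy]; simp
    rw [norm_mul, cpow_two_add hy, norm_mul, h1, mul_one, norm_real,
      Real.norm_eq_abs, abs_of_nonneg vonMangoldt_nonneg, norm_real, Real.norm_eq_abs,
      abs_of_nonneg (sq_nonneg _)]

/-- Continuity in `t` of `Λ(n) (x/n)^{2+it}`. [folklore] -/
theorem continuous_term (x : ℝ) (n : ℕ) :
    Continuous fun t : ℝ ↦ (Λ n : ℂ) * (((x / n : ℝ)) : ℂ) ^ (((2 : ℝ) : ℂ) + (t : ℂ) * I) := by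
  refine continuous_const.mul (Continuous.const_cpow (by fun_prop) (Or.inr fun t h ↦ ?_))
  have := congrArg Complex.re h
  simp at this

/-! ### The right edge -/

/-- **The Dirichlet-series side of Landau's formula** (crude uniform form). There is an absolute
`C > 0` such that for all `x > 1` and `T > 0`,
`‖∫_{−T}^{T} (−ζ'/ζ)(2+it) x^{2+it} dt − 2T Λ(x)‖ ≤ C (x² + x² min(T, x/⟨x⟩))`,
where `Λ(x) = Λ(n)` if `x = n` is an integer (then a prime power or `Λ(x) = 0`) and `Λ(x) = 0`
otherwise, and `⟨x⟩ = primePowDist x`: termwise integration of `∑ Λ(n)(x/n)^s` on `Re s = 2`, the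
term `n = x` giving `2T Λ(x)`, the others `≤ Λ(n)(x/n)² min(2T, 2/|log(x/n)|)` with
`|log(x/n)| ≥ log 2` off `(x/2, 2x)` and `≥ ⟨x⟩/(2x)` on it. [cite: Gonek1993, Thm. 1 (proof)] -/
theorem rightLine_bound :
    ∃ C : ℝ, 0 < C ∧ ∀ x : ℝ, 1 < x → ∀ T : ℝ, 0 < T →
      ‖(∫ t in (-T)..T, (fun s : ℂ ↦ (-deriv riemannZeta s / riemannZeta s) * (x : ℂ) ^ s)
            (((2 : ℝ) : ℂ) + t * I)) -
          ((2 * T * (if ((⌊x⌋₊ : ℕ) : ℝ) = x then Λ ⌊x⌋₊ else 0) : ℝ) : ℂ)‖ ≤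
        C * (x ^ 2 + x ^ 2 * min T (x / primePowDist x)) := by
  obtain ⟨K₀, hK₀0, hK₀⟩ := exists_tsum_vonMangoldt_div_rpow_le'
  obtain ⟨hsum2, htsum2⟩ := hK₀ 2 one_lt_two
  have htsum2' : ∑' n : ℕ, Λ n / (n : ℝ) ^ (2 : ℝ) ≤ 1 + K₀ := htsum2.trans (by norm_num)
  refine ⟨4 * (1 + K₀), by positivity, fun x hx T hT ↦ ?_⟩
  classical
  have hx0 : 0 < x := by linarith
  set S₂ : ℝ := ∑' n : ℕ, Λ n / (n : ℝ) ^ (2 : ℝ) with hS₂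
  have hS₂0 : 0 ≤ S₂ := tsum_nonneg fun n ↦ div_nonneg vonMangoldt_nonneg (by positivity)
  set m : ℝ := min T (x / primePowDist x) with hm
  have hpd := primePowDist_pos x
  have hm0 : 0 ≤ m := le_min hT.le (by positivity)
  -- the termwise data
  set F : ℕ → ℝ → ℂ := fun n t ↦ (Λ n : ℂ) * (((x / n : ℝ)) : ℂ) ^ (((2 : ℝ) : ℂ) + (t : ℂ) * I)
    with hF
  set f : ℝ → ℂ := fun t ↦ (fun s : ℂ ↦ (-deriv riemannZeta s / riemannZeta s) * (x : ℂ) ^ s)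
    (((2 : ℝ) : ℂ) + t * I) with hf
  -- the dominating series `Λ(n) (x/n)² = x² Λ(n)/n²`
  have hbound_eq : ∀ n : ℕ, Λ n * (x / n) ^ 2 = x ^ 2 * (Λ n / (n : ℝ) ^ (2 : ℝ)) := by
    intro n
    rw [Real.rpow_two]
    rcases Nat.eq_zero_or_pos n with rfl | hn
    · simp
    · have : (n : ℝ) ≠ 0 := by exact_mod_cast hn.ne'
      field_simp
  have hbsum : Summable fun n : ℕ ↦ Λ n * (x / n) ^ 2 :=
    (hsum2.mul_left (x ^ 2)).congr fun n ↦ (hbound_eq n).symm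
  -- (1) termwise integration
  have hDCT : HasSum (fun n ↦ ∫ t in (-T)..T, F n t) (∫ t in (-T)..T, f t) := by
    refine intervalIntegral.hasSum_integral_of_dominated_convergence
      (fun n _ ↦ Λ n * (x / n) ^ 2)
      (fun n ↦ (continuous_term x n).aestronglyMeasurable)
      (fun n ↦ Eventually.of_forall fun t _ ↦ norm_term_le hx0 n t)
      (Eventually.of_forall fun t _ ↦ hbsum) intervalIntegrable_const
      (Eventually.of_forall fun t _ ↦ ?_)
    have hs : 1 < (((2 : ℝ) : ℂ) + t * I).re := by simp
    exact hasSum_vonMangoldt_mul_cpow hx0 hs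
  -- (2) the main term
  set main : ℕ → ℂ := fun n ↦ if (n : ℝ) = x then (((2 * T * Λ n : ℝ)) : ℂ) else 0 with hmain
  have hmain0 : ∀ n : ℕ, n ≠ ⌊x⌋₊ → main n = 0 := by
    intro n hn
    have h : ¬ ((n : ℝ) = x) := fun h ↦ hn (by rw [← h, Nat.floor_natCast])
    simp only [hmain, if_neg h]
  have hmainsum : HasSum main (((2 * T * (if ((⌊x⌋₊ : ℕ) : ℝ) = x then Λ ⌊x⌋₊ else 0) : ℝ)) : ℂ) := by
    have h := hasSum_single (f := main) ⌊x⌋₊ (fun n hn ↦ hmain0 n hn)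
    have hval : main ⌊x⌋₊ = (((2 * T * (if ((⌊x⌋₊ : ℕ) : ℝ) = x then Λ ⌊x⌋₊ else 0) : ℝ)) : ℂ) := by
      simp only [hmain]
      split_ifs <;> simp
    rwa [hval] at h
  -- (3) the termwise error
  set g : ℕ → ℝ := fun n ↦ x ^ 2 * (3 + 4 * m) * (Λ n / (n : ℝ) ^ (2 : ℝ)) with hg
  have hg_eq : ∀ n : ℕ, g n = Λ n * (x / n) ^ 2 * (3 + 4 * m) := by
    intro n; simp only [hg]; rw [hbound_eq n]; ring
  have hgsum : HasSum g (x ^ 2 * (3 + 4 * m) * S₂) := (hsum2.hasSum).mul_left _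
  have hterm : ∀ n : ℕ, ‖(∫ t in (-T)..T, F n t) - main n‖ ≤ g n := by
    intro n
    have hgn0 : 0 ≤ g n := by
      rw [hg_eq]
      exact mul_nonneg (mul_nonneg vonMangoldt_nonneg (sq_nonneg _)) (by linarith)
    rcases Nat.eq_zero_or_pos n with rfl | hn
    · -- `n = 0`
      have h0 : main 0 = 0 := hmain0 0 (by
        intro h
        have : 0 < ⌊x⌋₊ := Nat.floor_pos.2 hx.le
        omega)
      rw [h0, sub_zero]
      simpa [hF] using hgn0
    have hnpos : (0 : ℝ) < n := by exact_mod_cast hn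
    have hy : 0 < x / n := div_pos hx0 hnpos
    -- the integral of the `n`-th term
    have hint : ∫ t in (-T)..T, F n t =
        (Λ n : ℂ) * ((((x / n) ^ 2 : ℝ)) : ℂ) * ∫ t in (-T)..T, ((x / n : ℝ) : ℂ) ^ ((t : ℂ) * I) := by
      simp only [hF, cpow_two_add hy]
      rw [← intervalIntegral.integral_const_mul]
      refine intervalIntegral.integral_congr fun t _ ↦ ?_
      ring
    by_cases hnx : (n : ℝ) = x
    · -- the main term `n = x`
      have hy1 : x / n = 1 := by rw [hnx, div_self hx0.ne']
      have hmn : main n = (((2 * T * Λ n : ℝ)) : ℂ) := by simp only [hmain, if_pos hnx]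
      rw [hint, hmn, hy1, integral_one_cpow_mul_I]
      have : (Λ n : ℂ) * ((((1 : ℝ) ^ 2 : ℝ)) : ℂ) * (2 * (T : ℂ)) - (((2 * T * Λ n : ℝ)) : ℂ) = 0 := by
        push_cast; ring
      rw [this, norm_zero]
      exact hgn0
    · have hmn : main n = 0 := by simp only [hmain, if_neg hnx]
      rw [hmn, sub_zero, hint, norm_mul, norm_mul, norm_real, Real.norm_eq_abs,
        abs_of_nonneg vonMangoldt_nonneg, norm_real, Real.norm_eq_abs, abs_of_nonneg (sq_nonneg _),
        hg_eq]
      by_cases hΛ : Λ n = 0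
      · rw [hΛ]; simp
      have hpp : IsPrimePow n := vonMangoldt_ne_zero_iff.1 hΛ
      refine mul_le_mul_of_nonneg_left ?_ (mul_nonneg vonMangoldt_nonneg (sq_nonneg _))
      have hy1 : x / n ≠ 1 := fun h ↦ hnx (by rw [div_eq_one_iff_eq hnpos.ne'] at h; exact h.symm)
      have hosc := norm_integral_cpow_mul_I_le hy hy1 hT.le
      -- `min(2T, 2/|log(x/n)|) ≤ 3 + 4m`
      refine hosc.trans ?_
      by_cases hnear : x / 2 < n ∧ (n : ℝ) < 2 * x
      · -- near `x`: `|log(x/n)| ≥ |x − n|/(2x) ≥ ⟨x⟩/(2x)`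
        have hdist := primePowDist_le (x := x) hpp hnx
        have hlog := abs_sub_div_le_abs_log hx0 hnear.1 hnear.2
        have hlogpos : 0 < |Real.log (x / n)| := by
          have : 0 < |x - n| := abs_pos.2 (sub_ne_zero.2 (Ne.symm hnx))
          exact lt_of_lt_of_le (by positivity) hlog
        have h1 : 2 / |Real.log (x / n)| ≤ 4 * (x / primePowDist x) := by
          rw [div_le_iff₀ hlogpos]
          have h2 : primePowDist x / (2 * x) ≤ |Real.log (x / n)| :=
            le_trans (div_le_div_of_nonneg_right hdist (by positivity)) hlog
          have h3 : primePowDist x ≤ 2 * x * |Real.log (x / n)| := by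
            rwa [div_le_iff₀ (by positivity), mul_comm] at h2
          calc (2 : ℝ) = 2 * primePowDist x * (1 / primePowDist x) := by field_simp
            _ ≤ 2 * (2 * x * |Real.log (x / n)|) * (1 / primePowDist x) := by gcongr
            _ = 4 * (x / primePowDist x) * |Real.log (x / n)| := by ring
        have h4 : min (2 * T) (2 / |Real.log (x / n)|) ≤ 4 * m := by
          rw [hm]
          rcases le_total T (x / primePowDist x) with h | h
          · rw [min_eq_left h]; exact (min_le_left _ _).trans (by linarith)
          · rw [min_eq_right h]; exact (min_le_right _ _).trans h1
        linarith
      · -- far from `x`: `|log(x/n)| ≥ log 2`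
        have hlog2 : Real.log 2 ≤ |Real.log (x / n)| := by
          rw [not_and_or] at hnear
          rcases hnear with h | h
          · push Not at h
            have h2 : 2 ≤ x / n := by rw [le_div_iff₀ hnpos]; linarith
            calc Real.log 2 ≤ Real.log (x / n) := Real.log_le_log two_pos h2
              _ ≤ |Real.log (x / n)| := le_abs_self _
          · push Not at h
            have h2 : 2 ≤ n / x := by rw [le_div_iff₀ hx0]; linarith
            calc Real.log 2 ≤ Real.log (n / x) := Real.log_le_log two_pos h2
              _ = -Real.log (x / n) := by rw [← Real.log_inv, inv_div]
              _ ≤ |Real.log (x / n)| := neg_le_abs _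
        have hl2 : (2 : ℝ) / 3 < Real.log 2 := by linarith [Real.log_two_gt_d9]
        have h1 : 2 / |Real.log (x / n)| ≤ 3 := by
          rw [div_le_iff₀ (lt_of_lt_of_le (by positivity) hlog2)]
          linarith
        exact (min_le_right _ _).trans (by linarith)
  -- (4) summation
  have hdiff := hDCT.sub hmainsum
  have hle := HasSum.norm_le_of_bounded hdiff hgsum hterm
  refine hle.trans ?_
  have h1 : x ^ 2 * (3 + 4 * m) * S₂ ≤ x ^ 2 * (3 + 4 * m) * (1 + K₀) :=
    mul_le_mul_of_nonneg_left htsum2' (by positivity)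
  have h2 : 0 ≤ (1 + K₀) * x ^ 2 := by positivity
  nlinarith [h1, h2]

end LandauGonek

end Literature.NumberTheory.LFunctions

end
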